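import Summits.Ventures.PercRepro.ProfilePointedCircuitClassesInOutTenE

/-!
# PercRepro — THE IN–OUT INEQUALITY AT THE BOTTOM OF NULLITY `3` ON EIGHT POINTS: `in_3(e) ≤ out_4(e)` AT EVERY
POINT OF EVERY EIGHT-POINT MATROID OF RANK `5` (p5, gen 51; `proofs/P5-GM1.md` §77)

The nullity-`3` member of the lane's in–out family (§59 is nullity `4` at `n = 10`, the twelve-point statement is
nullity `5`): on `#E = 8`, `ρ(E) = 5`, the bi-independent `3`-sets through `e` (DEMANDS, complement a basis) are at
most the bi-independent `4`-sets avoiding `e` (UNITS).  Here the disjointness relation `W ∩ W' = ∅` of §59 carries a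
LOCAL LYM WITHOUT ANY CHARGING: a demand `W` has `κ(W) := #{z ∈ E ∖ W : ρ(W + z) = 3} ≤ 2` when `N` is coloop-free
(three such points would span `cl W` and leave two points `x, y` with `ρ(E − x) ≤ 4`), so `W` has `s(W) ≥ 5 − 2 = 3`
disjoint units `(E ∖ W) − z`; a unit `W'` has `p(W') ≤ 3` disjoint demands `(E ∖ W') − z`, `z ≠ e`.  Double counting
the disjoint pairs, `3·#𝒟 ≤ Σ s = Σ p ≤ 3·#𝒰`.  A coloop `x ≠ e` gives the injection `W ↦ (E ∖ W) − x`, a coloop `e`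
has no demand.  THEOREM: **`inCount_three_le_outCount_four_of_card_eight`**.  It is one of the two ingredients of the
DOUBLE SERIES PAIR regime of the twelve-point statement (§77: two series pairs of `N` on a common `4`-circuit avoiding
`e`), where it appears on the minor `N ／ {a, b} ∖ {a', b'}`.
-/

open scoped Matroid

namespace PercRepro.Cogirth

open Finset ThmH Skew Shadow Profile

variable {α : Type} [DecidableEq α] {N : Matroid α} [N.Finite]

section InOutEight

variable {e : α}

/-- **`κ(W) ≤ 2`**: for a bi-independent `3`-set `W` of a coloop-free matroid with `#E = 8`, `ρ(E) = 5`, at most two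
points `z` of the basis `E ∖ W` have `ρ(W + z) = 3`. -/
theorem card_filter_rk_insert_eq_three_le_two (hn : (gr N).card = 8)
    (hcf : ∀ x ∈ gr N, rk N ((gr N).erase x) = 5) {W : Finset α} (hW : W ∈ biIndepSets N 3) :
    ((gr N \ W).filter (fun z => rk N (insert z W) = 3)).card ≤ 2 := by
  rw [mem_biIndepSets] at hW
  obtain ⟨hWg, hW3, hWrk, hWc⟩ := hW
  rw [hW3] at hWrk
  by_contra hcon
  have h3 : 3 ≤ ((gr N \ W).filter (fun z => rk N (insert z W) = 3)).card := by omega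
  obtain ⟨A, hAsub, hA3⟩ := exists_subset_card_eq h3
  have hAB : A ⊆ gr N \ W := hAsub.trans (filter_subset _ _)
  have hAg : A ⊆ gr N := hAB.trans sdiff_subset
  have hAcl : A ⊆ clF N W := by
    intro a ha
    have ha' := (mem_filter.1 (hAsub ha)).2
    rw [mem_clF_iff_rk_insert_eq (hAg ha) hWg, ha', hWrk]
  have hWA : rk N (W ∪ A) ≤ 3 := by
    have h1 : W ∪ A ⊆ clF N W :=
      union_subset (fun w hw => mem_clF_of_mem_of_subset_gr hWg hw) hAcl
    have h2 := rk_le_rk_of_subset_clF h1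
    omega
  have hBcard : (gr N \ W).card = 5 := by rw [card_sdiff_of_subset hWg, hn, hW3]
  have hBA : ((gr N \ W) \ A).card = 2 := by rw [card_sdiff_of_subset hAB, hBcard, hA3]
  obtain ⟨x, y, hxy, hBAxy⟩ := card_eq_two.1 hBA
  have hxBA : x ∈ (gr N \ W) \ A := by rw [hBAxy]; exact mem_insert_self x {y}
  have hyBA : y ∈ (gr N \ W) \ A := by rw [hBAxy]; exact mem_insert_of_mem (mem_singleton_self y)
  have hxg : x ∈ gr N := (mem_sdiff.1 (mem_sdiff.1 hxBA).1).1
  have hyg : y ∈ gr N := (mem_sdiff.1 (mem_sdiff.1 hyBA).1).1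
  have hsub : (gr N).erase x ⊆ insert y (W ∪ A) := by
    intro g hg
    rw [mem_erase] at hg
    rw [mem_insert, mem_union]
    by_cases hgW : g ∈ W
    · exact Or.inr (Or.inl hgW)
    by_cases hgA : g ∈ A
    · exact Or.inr (Or.inr hgA)
    have hgBA : g ∈ (gr N \ W) \ A := mem_sdiff.2 ⟨mem_sdiff.2 ⟨hg.2, hgW⟩, hgA⟩
    rw [hBAxy, mem_insert, mem_singleton] at hgBA
    rcases hgBA with h | h
    · exact absurd h hg.1
    · exact Or.inl h
  have h1 := rk_mono' (M := N) hsub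
  have h2 := rk_insert_le_add_one hyg (union_subset hWg hAg)
  have h3 := hcf x hxg
  omega

/-- The points `z ∈ E ∖ W` with `ρ(W + z) = 4` inject into the units disjoint from `W` (`z ↦ (E ∖ W) − z`). -/
theorem card_filter_rk_insert_eq_four_le_card_disjoint_units_eight (hn : (gr N).card = 8) {W : Finset α}
    (hW : W ∈ biIndepSets N 3) (heW : e ∈ W) :
    ((gr N \ W).filter (fun z => rk N (insert z W) = 4)).card ≤
      (((biIndepSets N 4).filter (fun W' => e ∉ W')).filter (fun W' => W ∩ W' = ∅)).card := by
  rw [mem_biIndepSets] at hW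
  obtain ⟨hWg, hW3, hWrk, hWc⟩ := hW
  have hBcard : (gr N \ W).card = 5 := by rw [card_sdiff_of_subset hWg, hn, hW3]
  apply card_le_card_of_injOn (fun z => (gr N \ W).erase z)
  · intro z hz
    rw [mem_coe, mem_filter, mem_sdiff] at hz
    obtain ⟨⟨hzg, hzW⟩, hz4⟩ := hz
    rw [mem_coe, mem_filter, mem_filter, mem_biIndepSets]
    have hzB : z ∈ gr N \ W := mem_sdiff.2 ⟨hzg, hzW⟩
    have hcompl : gr N \ (gr N \ W).erase z = insert z W := by
      ext g
      rw [mem_sdiff, mem_erase, mem_sdiff, mem_insert]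
      constructor
      · rintro ⟨hg, h⟩
        by_cases hgW : g ∈ W
        · exact Or.inr hgW
        · by_cases hgz : g = z
          · exact Or.inl hgz
          · exact absurd ⟨hgz, hg, hgW⟩ h
      · rintro (h | h)
        · subst h
          exact ⟨hzg, fun h => h.1 rfl⟩
        · exact ⟨hWg h, fun h' => h'.2.2 h⟩
    refine ⟨⟨⟨(erase_subset _ _).trans sdiff_subset, ?_, ?_, ?_⟩, ?_⟩, ?_⟩
    · rw [card_erase_of_mem hzB, hBcard]
    · rw [card_erase_of_mem hzB, hBcard]
      have := rk_eq_card_of_subset_of_rk_eq_card (M := N) (erase_subset z (gr N \ W)) hWc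
      rw [card_erase_of_mem hzB, hBcard] at this
      exact this
    · rw [hcompl, hz4, card_insert_of_notMem hzW, hW3]
    · intro he
      exact (mem_sdiff.1 (mem_of_mem_erase he)).2 heW
    · ext g
      simp only [mem_inter, mem_erase, mem_sdiff, notMem_empty, iff_false]
      tauto
  · intro z hz z' hz' h
    rw [mem_coe, mem_filter, mem_sdiff] at hz hz'
    simp only at h
    have h1 : z ∈ insert z ((gr N \ W).erase z) := mem_insert_self _ _
    rw [insert_erase (mem_sdiff.2 hz.1), ← insert_erase (mem_sdiff.2 hz'.1), ← h, mem_insert] at h1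
    rcases h1 with h1 | h1
    · exact h1
    · exact absurd (mem_erase.1 h1).1 (fun h => h rfl)

/-- **`p(W') ≤ 3`**: a unit `W'` (a bi-independent `4`-set avoiding `e`) has at most three disjoint demands
`(E ∖ W') − z`, `z ≠ e`. -/
theorem card_filter_disjoint_demands_le_three_eight (hn : (gr N).card = 8) (he : e ∈ gr N) {W' : Finset α}
    (hW' : W' ∈ (biIndepSets N 4).filter (fun W' => e ∉ W')) :
    (((biIndepSets N 3).filter (fun W => e ∈ W)).filter (fun W => W ∩ W' = ∅)).card ≤ 3 := by
  rw [mem_filter, mem_biIndepSets] at hW'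
  obtain ⟨⟨hW'g, hW'4, _, _⟩, heW'⟩ := hW'
  have hVcard : (gr N \ W').card = 4 := by rw [card_sdiff_of_subset hW'g, hn, hW'4]
  have heV : e ∈ gr N \ W' := mem_sdiff.2 ⟨he, heW'⟩
  have htarget : (((gr N \ W').erase e).powersetCard 1).card = 3 := by
    rw [card_powersetCard, card_erase_of_mem heV, hVcard, Nat.choose_one_right]
  refine (card_le_card_of_injOn (fun W => (gr N \ W') \ W) ?_ ?_).trans htarget.le
  · intro W hW
    rw [mem_coe, mem_filter, mem_filter, mem_biIndepSets] at hW
    obtain ⟨⟨⟨hWg, hW3, _, _⟩, heW⟩, hWW'⟩ := hW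
    have hWV : W ⊆ gr N \ W' :=
      subset_sdiff.2 ⟨hWg, disjoint_iff_inter_eq_empty.2 hWW'⟩
    rw [mem_coe, mem_powersetCard]
    refine ⟨?_, by rw [card_sdiff_of_subset hWV, hVcard, hW3]⟩
    intro g hg
    beta_reduce at hg
    rw [mem_sdiff] at hg
    exact mem_erase.2 ⟨fun h => hg.2 (h ▸ heW), hg.1⟩
  · intro W₁ hW₁ W₂ hW₂ h
    rw [mem_coe, mem_filter, mem_filter, mem_biIndepSets] at hW₁ hW₂
    have h₁ : W₁ ⊆ gr N \ W' :=
      subset_sdiff.2 ⟨hW₁.1.1.1, disjoint_iff_inter_eq_empty.2 hW₁.2⟩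
    have h₂ : W₂ ⊆ gr N \ W' :=
      subset_sdiff.2 ⟨hW₂.1.1.1, disjoint_iff_inter_eq_empty.2 hW₂.2⟩
    simp only at h
    rw [← Finset.sdiff_sdiff_eq_self h₁, ← Finset.sdiff_sdiff_eq_self h₂, h]

/-- **THE COLOOP-FREE CASE**: on `#E = 8`, `ρ(E) = 5` without coloops, `in_3(e) ≤ out_4(e)` by the local LYM of
disjointness (`s(W) ≥ 3 ≥ p(W')`). -/
theorem inCount_three_le_outCount_four_of_eight (hn : (gr N).card = 8)
    (hcf : ∀ x ∈ gr N, rk N ((gr N).erase x) = 5) (he : e ∈ gr N) : inCount N 3 e ≤ outCount N 4 e := by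
  unfold inCount outCount
  set D := (biIndepSets N 3).filter (fun W => e ∈ W) with hDdef
  set U := (biIndepSets N 4).filter (fun W' => e ∉ W') with hUdef
  have hdc : ∑ W ∈ D, (U.filter (fun W' => W ∩ W' = ∅)).card =
      ∑ W' ∈ U, (D.filter (fun W => W ∩ W' = ∅)).card := by
    have h := sum_card_bipartiteAbove_eq_sum_card_bipartiteBelow
      (r := fun (W W' : Finset α) => W ∩ W' = ∅) (s := D) (t := U)
    simp only [bipartiteAbove, bipartiteBelow] at h
    exact h
  have hlow : ∀ W ∈ D, 3 ≤ (U.filter (fun W' => W ∩ W' = ∅)).card := by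
    intro W hW
    have hW3 : W ∈ biIndepSets N 3 := (mem_filter.1 hW).1
    have heW : e ∈ W := (mem_filter.1 hW).2
    have hWg : W ⊆ gr N := (mem_biIndepSets.1 hW3).1
    have hWcard : W.card = 3 := (mem_biIndepSets.1 hW3).2.1
    have h1 := card_filter_rk_insert_eq_four_le_card_disjoint_units_eight hn hW3 heW
    rw [← hUdef] at h1
    have h2 := card_filter_rk_insert_eq_three_le_two hn hcf hW3
    have hBcard : (gr N \ W).card = 5 := by rw [card_sdiff_of_subset hWg, hn, hWcard]
    have hsplit := card_filter_add_card_filter_not (s := gr N \ W) (p := fun z => rk N (insert z W) = 4)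
    have hKeq : (gr N \ W).filter (fun z => ¬ rk N (insert z W) = 4) =
        (gr N \ W).filter (fun z => rk N (insert z W) = 3) := by
      apply filter_congr
      intro z hz
      have h3 := rk_insert_le_add_one (mem_sdiff.1 hz).1 hWg
      have h4 := rk_mono' (M := N) (subset_insert z W)
      have hWrk : rk N W = 3 := by rw [(mem_biIndepSets.1 hW3).2.2.1, hWcard]
      omega
    rw [hKeq, hBcard] at hsplit
    omega
  have hsumlow : D.card * 3 ≤ ∑ W ∈ D, (U.filter (fun W' => W ∩ W' = ∅)).card := by
    have h := card_nsmul_le_sum D (fun W => (U.filter (fun W' => W ∩ W' = ∅)).card) 3 hlow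
    rw [smul_eq_mul] at h
    exact h
  have hup : ∀ W' ∈ U, (D.filter (fun W => W ∩ W' = ∅)).card ≤ 3 := fun W' hW' =>
    card_filter_disjoint_demands_le_three_eight hn he hW'
  have hsumup : ∑ W' ∈ U, (D.filter (fun W => W ∩ W' = ∅)).card ≤ U.card * 3 := by
    have h := sum_le_card_nsmul U (fun W' => (D.filter (fun W => W ∩ W' = ∅)).card) 3 hup
    rw [smul_eq_mul] at h
    exact h
  omega

/-- A coloop `x ≠ e` settles the inequality: `W ↦ (E ∖ W) − x` injects the demands into the units. -/
theorem inCount_three_le_outCount_four_of_coloop_ne_eight (hn : (gr N).card = 8) (hR : rk N (gr N) = 5)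
    {x : α} (hx : x ∈ gr N) (hxe : x ≠ e) (hco : rk N ((gr N).erase x) < 5) :
    inCount N 3 e ≤ outCount N 4 e := by
  unfold inCount outCount
  apply card_le_card_of_injOn (fun W => (gr N \ W).erase x)
  · intro W hW
    rw [mem_coe, mem_filter, mem_biIndepSets] at hW
    obtain ⟨⟨hWg, hW3, hWrk, hWc⟩, heW⟩ := hW
    have hBcard : (gr N \ W).card = 5 := by rw [card_sdiff_of_subset hWg, hn, hW3]
    have hxW : x ∉ W := by
      intro hxW
      have hsub : gr N \ W ⊆ (gr N).erase x := by
        intro g hg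
        rw [mem_sdiff] at hg
        exact mem_erase.2 ⟨fun h => hg.2 (h ▸ hxW), hg.1⟩
      have h1 := rk_mono' (M := N) hsub
      rw [hWc, hBcard] at h1
      omega
    have hxB : x ∈ gr N \ W := mem_sdiff.2 ⟨hx, hxW⟩
    have hxcl : x ∉ clF N W := by
      intro hxcl
      have hWx : W ⊆ (gr N).erase x := fun g hg => mem_erase.2 ⟨fun h => hxW (h ▸ hg), hWg hg⟩
      have h1 : x ∈ clF N ((gr N).erase x) := mem_clF_of_subset hWx hxcl
      rw [mem_clF_iff_rk_insert_eq hx (erase_subset x (gr N)), insert_erase hx] at h1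
      omega
    have hcompl : gr N \ (gr N \ W).erase x = insert x W := by
      ext g
      rw [mem_sdiff, mem_erase, mem_sdiff, mem_insert]
      constructor
      · rintro ⟨hg, h⟩
        by_cases hgW : g ∈ W
        · exact Or.inr hgW
        · by_cases hgx : g = x
          · exact Or.inl hgx
          · exact absurd ⟨hgx, hg, hgW⟩ h
      · rintro (h | h)
        · subst h
          exact ⟨hx, fun h => h.1 rfl⟩
        · exact ⟨hWg h, fun h' => h'.2.2 h⟩
    rw [mem_coe, mem_filter, mem_biIndepSets]
    refine ⟨⟨(erase_subset _ _).trans sdiff_subset, ?_, ?_, ?_⟩, ?_⟩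
    · rw [card_erase_of_mem hxB, hBcard]
    · rw [card_erase_of_mem hxB, hBcard]
      have := rk_eq_card_of_subset_of_rk_eq_card (M := N) (erase_subset x (gr N \ W)) hWc
      rwa [card_erase_of_mem hxB, hBcard] at this
    · rw [hcompl, rk_insert_eq hx hWg, if_neg hxcl, hWrk, card_insert_of_notMem hxW]
    · intro he
      exact (mem_sdiff.1 (mem_of_mem_erase he)).2 heW
  · intro W₁ hW₁ W₂ hW₂ h
    rw [mem_coe, mem_filter, mem_biIndepSets] at hW₁ hW₂
    simp only at h
    have hx₁ : x ∈ gr N \ W₁ := by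
      refine mem_sdiff.2 ⟨hx, fun hxW => ?_⟩
      have hsub : gr N \ W₁ ⊆ (gr N).erase x := by
        intro g hg
        rw [mem_sdiff] at hg
        exact mem_erase.2 ⟨fun h => hg.2 (h ▸ hxW), hg.1⟩
      have h1 := rk_mono' (M := N) hsub
      rw [hW₁.1.2.2.2, card_sdiff_of_subset hW₁.1.1, hn, hW₁.1.2.1] at h1
      omega
    have hx₂ : x ∈ gr N \ W₂ := by
      refine mem_sdiff.2 ⟨hx, fun hxW => ?_⟩
      have hsub : gr N \ W₂ ⊆ (gr N).erase x := by
        intro g hg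
        rw [mem_sdiff] at hg
        exact mem_erase.2 ⟨fun h => hg.2 (h ▸ hxW), hg.1⟩
      have h1 := rk_mono' (M := N) hsub
      rw [hW₂.1.2.2.2, card_sdiff_of_subset hW₂.1.1, hn, hW₂.1.2.1] at h1
      omega
    have h2 : gr N \ W₁ = gr N \ W₂ := by
      rw [← insert_erase hx₁, ← insert_erase hx₂, h]
    rw [← Finset.sdiff_sdiff_eq_self hW₁.1.1, ← Finset.sdiff_sdiff_eq_self hW₂.1.1, h2]

/-- **THE IN–OUT INEQUALITY AT `n = 8`, EVERY POINT**: on every matroid with `#E = 8` and `ρ(E) = 5`,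
`in_3(e) ≤ out_4(e)` for every `e ∈ E`. -/
theorem inCount_three_le_outCount_four_of_card_eight (hn : (gr N).card = 8) (hR : rk N (gr N) = 5)
    (he : e ∈ gr N) : inCount N 3 e ≤ outCount N 4 e := by
  -- `e` a coloop: no demand
  by_cases hce : rk N ((gr N).erase e) < rk N (gr N)
  · have h0 := inCount_eq_zero_of_coloop hce
    rw [hn, hR] at h0
    simp only [Nat.reduceSub] at h0
    rw [h0]
    exact Nat.zero_le _
  -- a coloop `x ≠ e`
  by_cases hall : ∀ x ∈ gr N, rk N ((gr N).erase x) = 5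
  · exact inCount_three_le_outCount_four_of_eight hn hall he
  obtain ⟨x, hx, hxr⟩ : ∃ x ∈ gr N, rk N ((gr N).erase x) ≠ 5 := by
    simpa only [not_forall, exists_prop] using hall
  have hxe : x ≠ e := by
    rintro rfl
    have := rk_mono' (M := N) (erase_subset x (gr N))
    omega
  have hco : rk N ((gr N).erase x) < 5 := by
    have := rk_mono' (M := N) (erase_subset x (gr N))
    omega
  exact inCount_three_le_outCount_four_of_coloop_ne_eight hn hR hx hxe hco

end InOutEight

end PercRepro.Cogirth
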